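import Summits.ABC.IUTFork.Conditional.AbcOfStatementGenuineM
import Summits.ABC.IUTFork.Conditional.AbcOfSlackRegimeSzpiro
import Summits.ABC.IUTFork.LDHGenuineHullRegimeMixedPoint
import Summits.ABC.ABC.Theorems.IUTThetaPilotThetaPartIIDegLe
import HarnessLib

/-!
# Branch C — the DOWNSTREAM certificate at genuine data (`abc_of_cor312Statement_genuineM`, abc-iut-C-cert-3 p443000) with its CONE binder
# CUT: the degree-one cut (NO cone binder — explicit 1 = [C312] only) and the three landed (P,l)-level cone currencies (hresSz / hSz / hMix)

C scoreboard (R2 S-chain team, abc-iut-s2-p10 «float to TARGET #1»; PROOF-ONLY file: no `def`, no new `Prop`, no instance, no notation;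
every hypothesis text is copied VERBATIM from the landed theorem it is fed to, every proof is a composition BY NAME).

abc-iut-C-cert-3's `Conditional.abc_of_cor312Statement_genuineM` (p443000) reads «`ABC` ⟸ [C312] `hst` + [CONE] `hreg`» where `hst` is the
TYPED [IUTchIII] Cor. 3.12 `Cor312.Setting.Statement` (abc-iut-c312-7, DEFS-FROZEN: `−|log(Θ)| ≠ ⊤ ∧ −|log(q)| ≤ −|log(Θ)|` for the setting's own
pilot regions) at the summand-route M-level genuine real setting `settingPrVolSharpM T.D …` of every ADMISSIBLE genuine Θ-volume datum (pilot
regions read off the datum's OWN Θ- and q-ideles, abc-iut-w5-d033), and `hreg` is the typed residue of [IUTchIV] Thm. 1.10's volume computation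
(abc-iut-c312-8 p428563: the hull estimate with print's `B_III(λ,l)` demanded only at NON-slot-constant data). Per datum `hSH ⟹ hst`
(abc-iut-C-cert-3 `GenuineMStatement.statement_of_SH`, p443737), so every theorem below is STRONGER, at equal explicit count, than its twin on
the M-level S_H line (`vojta_degOne_of_SH_v10M` abc-iut-w6-d115 p443731; `abc_of_SH_v10M_szpiroSlack` / `_szpiroSuff` / `_pointMixedSzpiro`
abc-iut-s2-p10 p442811), and its one IUT-side binder is the typed Corollary itself rather than a hull-level reading of Step (xi).

* §1 `GenuineMStatement.cor312AtDatum_of_statement` — the [C312] family ALONE gives `Cor22.Cor312AtDatum P l` (abc-iut-S2's Dupuy–Hilado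
  inequality `T.Cor312Of` at every genuine Θ-volume datum) at every admissible `(P, l)`: the `h312` slot of EVERY (U)-line capstone in the tree.
  Proof: abc-iut-w5-d244's hypothesis-free `cor312Of_of_statement_settingPrVolSharpM` (p442412) at `T.D`, `T.isVolumeInputOf` — the per-datum
  step of p443000, isolated.
* §2 `vojta_degOne_of_cor312Statement_genuineM` — THE DEGREE-ONE CUT: from p443000's data binders VERBATIM and `hst` with ONE extra guard
  `P.degree ≤ 1` (strictly WEAKER than p443000's `hst`), NOTHING ELSE: Vojta's height inequality with the printed `1+ε` for the degree-`1`
  points of every compactly bounded `K_V` whose support contains `2` («abc for the triples balanced at `2` and `∞`», [IUTchIV] Cor. 2.2 (ii) /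
  Cor. 2.3 at `d = 1`). EXPLICIT 1 = [C312] ONLY (CONE 0 · S/S_H 0 · PIN 0 · BRIDGE 0 · PROVENANCE 0 · READ 0 · SIDE 0 · FACT 0): at rational
  points `d_mod = 1`, there is one place of `F_mod` over each prime, the (Ind1) slot residue vanishes and the hull-volume estimate is the THEOREM
  `ThetaPartIIDisplay.hullVolumeAtDatum_BIII_of_degree_le_one` (abc-iut-S2 over abc-iut-S3's pinned `d_mod = 1` computation and abc-iut-S1's
  tower facts), inside `ThetaPartIIDisplay.vojtaIneq_two_degOne_of_cor312`. READING: «modulo NOTHING, the typed [IUTchIII] Cor. 3.12 at the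
  M-level genuine settings of the admissible Θ-data of the RATIONAL points of the `λ`-line implies, in the kernel, Vojta(`1+ε`) for those
  points on every `K_V ∋ 2`»; what the CONE binder buys on top is exactly [GenEll] Thm. 2.1 (ii)⇒(i)'s passage to points of degree `> 1`
  (cover `Y → X` of index `e ≥ 3(1+ε′)/ε′`), i.e. from balanced triples to `Summit.ABC` (abc-iut-w6-d115's analysis, p443731 docstring).
* §3 the three cone currencies, each «`ABC` ⟸ [C312] `hst` + ONE landed (P,l)-level cone input», explicit 2 = C312 1 · CONE 1:
  `abc_of_cor312Statement_genuineM_szpiroSlack` (`hresSz`, abc-iut-s2-p10 p436259's Szpiro-slack residue cut — the strongest landed cut: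
  `hreg ⟹ hres ⟹ hresSz` by `slackRegime_of_hullRegime`, `szpiroSlackRegime_of_slackRegime`), `…_szpiroSuff` (`hSz`, abc-iut-s2-p1 p435048's
  DATUM-FREE Szpiro-type inequality WITH π-slack — the only admissible form of the Szpiro trade: the slack-free form is REFUTED as a ∀-binder,
  abc-iut-s2-p5 `QuadWitness.not_szpiroPure` p442698), `…_pointMixedSzpiro` (`hMix`, abc-iut-s2-p1 p438083's datum-free mixed-height bound).
  Tails `Conditional.ABC_of_cor312_of_szpiroSlackRegime` / `Conditional.ABC_of_cor312_of_szpiroSuff` / `ABC_of_cor312_of_pointMixedSzpiro`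
  BY NAME over §1. TARGET #1 of the R2 team («close the (Ind1) slot residue at `d_mod > 1` or certify its Szpiro-type obstruction») ended
  CERTIFIED (abc-iut-s2-p5 12:05Z: `hreg` implies an effective Szpiro-type pair bound on the whole unequal-heights locus, p443060 / p443665;
  that locus is non-empty of unbounded height, p441759 / p442698), so these cuts record the exact Diophantine price of the cone in each landed
  currency next to the cone-free degree-one statement of §2; none of `hresSz` / `hSz` / `hMix` is asserted.

HONEST FRAMING: this campaign LOCATES / CONDITIONALLY VERIFIES. Nothing here asserts that abc (balanced or not) is proved or refuted, or that
[IUTchIII] Cor. 3.12 / Thm. 3.11 holds or fails at any datum, or takes a side on any author (Mochizuki / Scholze–Stix / Joshi /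
Dupuy–Hilado); `hst` is an assumption label — the typed Cor. 3.12 at OUR genuine M-level settings, whose status is exactly the adjudication's
subject (at these settings it is ONE real inequality `I.negAbsLogQ ≤ θ` on the hull volume `θ`, abc-iut-w5-d244 12:05:53Z; its hull-level
(xi-f) supplier S_H is refuted as typed on the K-line of record, abc-iut-C-cert-1 `not_hSH_v6K` p443604 — «refuted as typed» ≠ «refuted in
print», and nothing is claimed here about `hst` itself); `hresSz` / `hSz` / `hMix` are unproved Szpiro-type inequalities. typed ≠ proved;
instantiated ≠ endorsed. [claim: Mochizuki2012, status: disputed]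
[cite: Mochizuki2012, IUTchIII Cor. 3.12 p. 173–174; IUTchIV Thm. 1.10 p. 22–31 (Step (v) p. 27–28), Cor. 2.2 (ii)–(iii) p. 43–47, Cor. 2.3 p. 54–55]
[cite: MochizukiGenEll2010, Thm. 2.1 p. 12] [cite: DupuyHilado2025, §3.4, Thm. 3.10.1]
-/

noncomputable section

open Set Function NumberField IsDedekindDomain

namespace Summit.ABC.IUTFork.Conditional

open Thm311 Thm311.Real Cor312 Cor312Vol Cor312Prov Literature.IUT.LogThetaLattice Literature.IUT.LogVolume
  Literature.IUT.HodgeTheaters Literature.IUT.LogVolume.ThetaData Literature.NumberTheory.NumberFields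
open Literature.NumberTheory.DiophantineGeometry Literature.NumberTheory.DiophantineGeometry.GenEll Summit.ABC.ABC.Theorems

section Family

/-! ## §0. DATA of the family — p443000's context binders VERBATIM, as section variables: per `λ`-line point `P`, prime `l` and genuine
Θ-volume datum `T`, the context binders of abc-iut-s2-p8's summand-route M-level sharp setting `settingPrVolSharpM T.D …` (logs FIXED:
analytic) and the column data — NO `qK`, NO `ρ` (the typed `Statement` needs no region reading), NO pilot-data / provenance / idele binder -/

variable
    (M : ∀ (P : NFPoint) (l : ℕ) (T : Cor22.ThetaVolumeDatumAt P l), Type) [∀ P l T, Field (M P l T)] [∀ P l T, NumberField (M P l T)]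
    (archPk : ∀ (P : NFPoint) (l : ℕ) (T : Cor22.ThetaVolumeDatumAt P l), letI := T.instFieldF; letI := T.instNumberFieldF; letI := T.instAlgebraF; letI := T.instFieldK;
        letI := T.instNumberFieldK; letI := T.instAlgebraK; letI := T.instFieldFbar; letI := T.instAlgebraFbar;
        letI := T.instAlgebraKFbar; letI := T.instIsElliptic;
      ∀ (j : (thetaIndexOfInitial T.D).Label) (vQ : (thetaIndexOfInitial T.D).VQ), Set ((logShellsOfInitialDH T.D (analyticLogvVal T.K)).Packet j vQ))
    (archSub : ∀ (P : NFPoint) (l : ℕ) (T : Cor22.ThetaVolumeDatumAt P l), letI := T.instFieldF; letI := T.instNumberFieldF; letI := T.instAlgebraF; letI := T.instFieldK;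
        letI := T.instNumberFieldK; letI := T.instAlgebraK; letI := T.instFieldFbar; letI := T.instAlgebraFbar;
        letI := T.instAlgebraKFbar; letI := T.instIsElliptic;
      ∀ (j : (thetaIndexOfInitial T.D).Label) (v : (thetaIndexOfInitial T.D).V), Set ((logShellsOfInitialDH T.D (analyticLogvVal T.K)).Packet j ((thetaIndexOfInitial T.D).over v)))
    (Ψ : ∀ (P : NFPoint) (l : ℕ) (T : Cor22.ThetaVolumeDatumAt P l), letI := T.instFieldF; letI := T.instNumberFieldF; letI := T.instAlgebraF; letI := T.instFieldK;
        letI := T.instNumberFieldK; letI := T.instAlgebraK; letI := T.instFieldFbar; letI := T.instAlgebraFbar;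
        letI := T.instAlgebraKFbar; letI := T.instIsElliptic;
      ℤ → ∀ v : (thetaIndexOfInitial T.D).V, v ∈ (thetaIndexOfInitial T.D).Vbad → Set ((logShellsOfInitialDH T.D (analyticLogvVal T.K)).StarPacket v))
    (act : ∀ (P : NFPoint) (l : ℕ) (T : Cor22.ThetaVolumeDatumAt P l), letI := T.instFieldF; letI := T.instNumberFieldF; letI := T.instAlgebraF; letI := T.instFieldK;
        letI := T.instNumberFieldK; letI := T.instAlgebraK; letI := T.instFieldFbar; letI := T.instAlgebraFbar;
        letI := T.instAlgebraKFbar; letI := T.instIsElliptic;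
      ℤ → ∀ v : (thetaIndexOfInitial T.D).V, v ∈ (thetaIndexOfInitial T.D).Vbad → (logShellsOfInitialDH T.D (analyticLogvVal T.K)).StarPacket v → Module.End ℚ ((logShellsOfInitialDH T.D (analyticLogvVal T.K)).StarPacket v))
    (Mmod : ∀ (P : NFPoint) (l : ℕ) (T : Cor22.ThetaVolumeDatumAt P l), letI := T.instFieldF; letI := T.instNumberFieldF; letI := T.instAlgebraF; letI := T.instFieldK;
        letI := T.instNumberFieldK; letI := T.instAlgebraK; letI := T.instFieldFbar; letI := T.instAlgebraFbar;
        letI := T.instAlgebraKFbar; letI := T.instIsElliptic;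
      ℤ → ∀ j : (thetaIndexOfInitial T.D).LabelStar, Set ((logShellsOfInitialDH T.D (analyticLogvVal T.K)).GlobalPacket j.1))
    (region : ∀ (P : NFPoint) (l : ℕ) (T : Cor22.ThetaVolumeDatumAt P l), letI := T.instFieldF; letI := T.instNumberFieldF; letI := T.instAlgebraF; letI := T.instFieldK;
        letI := T.instNumberFieldK; letI := T.instAlgebraK; letI := T.instFieldFbar; letI := T.instAlgebraFbar;
        letI := T.instAlgebraKFbar; letI := T.instIsElliptic;
      ℤ → ∀ j : (thetaIndexOfInitial T.D).LabelStar, FinDivisor (M P l T) → ∀ vQ : (thetaIndexOfInitial T.D).VQ, Set ((logShellsOfInitialDH T.D (analyticLogvVal T.K)).Packet j.1 vQ))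
    (n : ∀ (P : NFPoint) (l : ℕ) (T : Cor22.ThetaVolumeDatumAt P l), ℤ)
    {HT : ∀ (P : NFPoint) (l : ℕ) (T : Cor22.ThetaVolumeDatumAt P l), Type} {LogLink : ∀ (P : NFPoint) (l : ℕ) (T : Cor22.ThetaVolumeDatumAt P l), HT P l T → HT P l T → Type}
    {IsFull : ∀ (P : NFPoint) (l : ℕ) (T : Cor22.ThetaVolumeDatumAt P l), ∀ {s t : HT P l T}, LogLink P l T s t → Prop}
    (lat : ∀ (P : NFPoint) (l : ℕ) (T : Cor22.ThetaVolumeDatumAt P l), LGPGaussianLogThetaLattice (LogLink P l T) (IsFull P l T))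
    {Frd : ∀ (P : NFPoint) (l : ℕ) (T : Cor22.ThetaVolumeDatumAt P l), Type} {IsoF : ∀ (P : NFPoint) (l : ℕ) (T : Cor22.ThetaVolumeDatumAt P l), Frd P l T → Frd P l T → Type} {Ob : ∀ (P : NFPoint) (l : ℕ) (T : Cor22.ThetaVolumeDatumAt P l), Frd P l T → Type}
    {realify : ∀ (P : NFPoint) (l : ℕ) (T : Cor22.ThetaVolumeDatumAt P l), Frd P l T → Frd P l T} {Strip : ∀ (P : NFPoint) (l : ℕ) (T : Cor22.ThetaVolumeDatumAt P l), Type} {IsoS : ∀ (P : NFPoint) (l : ℕ) (T : Cor22.ThetaVolumeDatumAt P l), Strip P l T → Strip P l T → Type}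
    {Mv : ∀ (P : NFPoint) (l : ℕ) (T : Cor22.ThetaVolumeDatumAt P l), letI := T.instFieldF; letI := T.instNumberFieldF; letI := T.instAlgebraF; letI := T.instFieldK;
        letI := T.instNumberFieldK; letI := T.instAlgebraK; letI := T.instFieldFbar; letI := T.instAlgebraFbar;
        letI := T.instAlgebraKFbar; letI := T.instIsElliptic;
      ∀ v : (thetaIndexOfInitial T.D).V, v ∈ (thetaIndexOfInitial T.D).Vbad → Type}
    [∀ P l T v h, Monoid (Mv P l T v h)]
    (sig : ∀ (P : NFPoint) (l : ℕ) (T : Cor22.ThetaVolumeDatumAt P l), letI := T.instFieldF; letI := T.instNumberFieldF; letI := T.instAlgebraF; letI := T.instFieldK;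
        letI := T.instNumberFieldK; letI := T.instAlgebraK; letI := T.instFieldFbar; letI := T.instAlgebraFbar;
        letI := T.instAlgebraKFbar; letI := T.instIsElliptic;
      GlobalLGPFrobenioidSignature (thetaIndexOfInitial T.D).lstar (thetaIndexOfInitial T.D).V (· ∈ (thetaIndexOfInitial T.D).Vbad) (Frd P l T) (IsoF P l T) (Ob P l T) (realify P l T)
        (Strip P l T) (IsoS P l T) (Mv P l T))
    (split : ∀ (P : NFPoint) (l : ℕ) (T : Cor22.ThetaVolumeDatumAt P l), SplittingMonoids (Mv P l T))
    {ObΔ : ∀ (P : NFPoint) (l : ℕ) (T : Cor22.ThetaVolumeDatumAt P l), Type}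
    {N : ∀ (P : NFPoint) (l : ℕ) (T : Cor22.ThetaVolumeDatumAt P l), letI := T.instFieldF; letI := T.instNumberFieldF; letI := T.instAlgebraF; letI := T.instFieldK;
        letI := T.instNumberFieldK; letI := T.instAlgebraK; letI := T.instFieldFbar; letI := T.instAlgebraFbar;
        letI := T.instAlgebraKFbar; letI := T.instIsElliptic;
      ∀ v : (thetaIndexOfInitial T.D).V, v ∈ (thetaIndexOfInitial T.D).Vbad → Type}
    [∀ P l T v h, Monoid (N P l T v h)] (qData : ∀ (P : NFPoint) (l : ℕ) (T : Cor22.ThetaVolumeDatumAt P l), QPilotData (ObΔ P l T) (N P l T))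

/-! ## §1. The [C312] family ALONE gives [IUTchIII] Cor. 3.12's Dupuy–Hilado form at every admissible genuine Θ-volume datum -/

/-- **[C312] family ⟹ `Cor22.Cor312AtDatum P l` at every ADMISSIBLE `(P, l)`** (`P ∈ UP`, `l` prime `≥ 5`, «admits an `F`-core», (P2),
(P5), (P6)) — the `h312` slot of every (U)-line capstone (`ThetaPartII.ABC_of_cor312_of_hullRegime` p428563, `…_of_slackRegime` p434025,
`…_of_szpiroSlackRegime` p436259, `…_of_szpiroSuff` p435048, `ABC_of_cor312_of_pointMixedSzpiro` p438083, `ThetaPartIIDisplay.vojtaIneq_two_degOne_of_cor312`),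
from p443000's [C312] binder VERBATIM: the typed `Cor312.Setting.Statement` of abc-iut-s2-p8's summand-route M-level sharp setting of the datum's
OWN Θ- and q-ideles (abc-iut-w5-d033 `tOfIdeleData` / `tqM` of `ideleDataOf T.D T.isVolumeInputOf`; `Sq`, `htq1` the theorems of abc-iut-C-cert-3
p438616). Proof: abc-iut-w5-d244's hypothesis-free `cor312Of_of_statement_settingPrVolSharpM` (p442412; q-side abc-iut-S2's number p440575, Θ-side
abc-iut-s2-p8's closer p440655) at `T.D`, `T.isVolumeInputOf` — the per-datum step of `abc_of_cor312Statement_genuineM`, isolated for re-use.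
«Cor. 3.12's Dupuy–Hilado form at these data follows from the typed Cor. 3.12 at these settings» — no side taken on [IUTchIII] Cor. 3.12; `hst` is
an assumption label; typed ≠ proved; instantiated ≠ endorsed. [claim: Mochizuki2012, status: disputed] -/
theorem GenuineMStatement.cor312AtDatum_of_statement
    -- [C312] the TYPED [IUTchIII] Cor 3.12 `Statement` at the summand-route M-level genuine real setting of the datum's OWN ideles, ADMISSIBLE (P,l) only — p443000's binder verbatim
    (hst : ∀ (P : NFPoint), P ∈ UP → ∀ (l : ℕ), l.Prime → 5 ≤ l →
      Cor22.AdmitsCore P → Cor22.CondP2 P l → Cor22.CondP5 P l → Cor22.CondP6 P l →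
      ∀ (T : Cor22.ThetaVolumeDatumAt P l), letI := T.instFieldF; letI := T.instNumberFieldF; letI := T.instAlgebraF; letI := T.instFieldK;
        letI := T.instNumberFieldK; letI := T.instAlgebraK; letI := T.instFieldFbar; letI := T.instAlgebraFbar;
        letI := T.instAlgebraKFbar; letI := T.instIsElliptic;
      (settingPrVolSharpM T.D (logvAnalyticVal_analyticLogvVal (K := T.K)) (tOfIdeleData T.D (ideleDataOf T.D T.isVolumeInputOf))
          (fun u x => tqM T.D (ratChar u) u (natCast_ratChar_mem u) (ideleDataOf T.D T.isVolumeInputOf) x)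
          (M P l T) (archPk P l T) (archSub P l T) (Ψ P l T) (act P l T)
          (Mmod P l T) (region P l T) (n P l T) (lat P l T) (sig P l T) (split P l T) (qData P l T)
          (fun u x => tqM_ne_zero T.D (ratChar u) u (natCast_ratChar_mem u) (ideleDataOf T.D T.isVolumeInputOf) x)
          (GenuineM.finite_ratPlaces_under_S T.D).toFinset
          (fun u x hu => norm_tqM_eq_one_of_not_mem T.D (ratChar u) u (natCast_ratChar_mem u) (ideleDataOf T.D T.isVolumeInputOf) x
            fun hx => hu ((Set.Finite.mem_toFinset _).mpr ⟨x, hx⟩))).Statement) :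
    ∀ P : NFPoint, P ∈ UP → ∀ l : ℕ, l.Prime → 5 ≤ l →
      Cor22.AdmitsCore P → Cor22.CondP2 P l → Cor22.CondP5 P l → Cor22.CondP6 P l → Cor22.Cor312AtDatum P l := by
  intro P hP l hl h5 hc h2 h5' h6 T
  letI := T.instFieldF; letI := T.instNumberFieldF; letI := T.instAlgebraF; letI := T.instFieldK
  letI := T.instNumberFieldK; letI := T.instAlgebraK; letI := T.instFieldFbar; letI := T.instAlgebraFbar
  letI := T.instAlgebraKFbar; letI := T.instIsElliptic
  exact cor312Of_of_statement_settingPrVolSharpM T.D (logvAnalyticVal_analyticLogvVal (K := T.K)) T.isVolumeInputOf (M P l T)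
    (archPk P l T) (archSub P l T) (Ψ P l T) (act P l T) (Mmod P l T) (region P l T) (n P l T) (lat P l T) (sig P l T) (split P l T)
    (qData P l T) (GenuineM.finite_ratPlaces_under_S T.D).toFinset
    (fun u x hu => norm_tqM_eq_one_of_not_mem T.D (ratChar u) u (natCast_ratChar_mem u) (ideleDataOf T.D T.isVolumeInputOf) x
      fun hx => hu ((Set.Finite.mem_toFinset _).mpr ⟨x, hx⟩))
    (hst P hP l hl h5 hc h2 h5' h6 T)

/-! ## §2. THE DEGREE-ONE CUT: Vojta(`1+ε`) for the rational points of the `λ`-line on every `K_V ∋ 2`, from [C312] ALONE — explicit 1 -/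

/-- **`vojta_degOne_of_cor312Statement_genuineM` (the DOWNSTREAM certificate, DEGREE-ONE CUT; explicit 1 = [C312] 1 · CONE 0).** Vojta's
height inequality with the printed `1+ε` for the degree-`1` points of every compactly bounded `K_V` whose support contains `2` — from
p443000's data (summand-route M-level sharp setting of each datum's OWN ideles, logs analytic) and the ONE hypothesis [C312] `hst`: the TYPED
[IUTchIII] Cor. 3.12 `Cor312.Setting.Statement` of that setting, demanded only at admissible RATIONAL points (`P ∈ U_P`, `P.degree ≤ 1`, `l`
prime `≥ 5`, `AdmitsCore`, (P2), (P5), (P6)) — p443000's binder with ONE extra guard, strictly weaker. NO hull-volume / CONE binder (a theorem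
at `d_mod = 1`, inside `ThetaPartIIDisplay.vojtaIneq_two_degOne_of_cor312`), no S / S_H / pin / bridge / provenance / read / orbit / side binder
(theorems inside abc-iut-w5-d244's `cor312Of_of_statement_settingPrVolSharpM`). STRONGER than abc-iut-w6-d115's `vojta_degOne_of_SH_v10M` at
equal count (per datum `hSH ⟹ hst`, abc-iut-C-cert-3 p443737). «Vojta at degree 1 on `K_V ∋ 2` follows from the typed Cor. 3.12 at these
settings, as typed» — no side taken on [IUTchIII] Cor. 3.12; typed ≠ proved; instantiated ≠ endorsed. [claim: Mochizuki2012, status: disputed] -/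
theorem vojta_degOne_of_cor312Statement_genuineM
    -- [C312] p443000's binder with ONE extra guard `P.degree ≤ 1` (admissible RATIONAL (P,l) only)
    (hst : ∀ (P : NFPoint), P ∈ UP → P.degree ≤ 1 → ∀ (l : ℕ), l.Prime → 5 ≤ l →
      Cor22.AdmitsCore P → Cor22.CondP2 P l → Cor22.CondP5 P l → Cor22.CondP6 P l →
      ∀ (T : Cor22.ThetaVolumeDatumAt P l), letI := T.instFieldF; letI := T.instNumberFieldF; letI := T.instAlgebraF; letI := T.instFieldK;
        letI := T.instNumberFieldK; letI := T.instAlgebraK; letI := T.instFieldFbar; letI := T.instAlgebraFbar;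
        letI := T.instAlgebraKFbar; letI := T.instIsElliptic;
      (settingPrVolSharpM T.D (logvAnalyticVal_analyticLogvVal (K := T.K)) (tOfIdeleData T.D (ideleDataOf T.D T.isVolumeInputOf))
          (fun u x => tqM T.D (ratChar u) u (natCast_ratChar_mem u) (ideleDataOf T.D T.isVolumeInputOf) x)
          (M P l T) (archPk P l T) (archSub P l T) (Ψ P l T) (act P l T)
          (Mmod P l T) (region P l T) (n P l T) (lat P l T) (sig P l T) (split P l T) (qData P l T)
          (fun u x => tqM_ne_zero T.D (ratChar u) u (natCast_ratChar_mem u) (ideleDataOf T.D T.isVolumeInputOf) x)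
          (GenuineM.finite_ratPlaces_under_S T.D).toFinset
          (fun u x hu => norm_tqM_eq_one_of_not_mem T.D (ratChar u) u (natCast_ratChar_mem u) (ideleDataOf T.D T.isVolumeInputOf) x
            fun hx => hu ((Set.Finite.mem_toFinset _).mpr ⟨x, hx⟩))).Statement)
    -- [CONE] NONE (`d_mod = 1` at rational points) · [S]/[S_H] [PIN] [PROV] [BRIDGE] [READ] [ORBIT] [SIDE] [FACT] none (theorems inside)
    {ε : ℝ} (hε : 0 < ε) (D : CBData) (hD : D.SupportContains {2}) : VojtaIneq D.toSet 1 ε := by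
  -- the typed Cor 3.12 at every ADMISSIBLE genuine Θ-volume datum of a RATIONAL point ⟹ S2's Dupuy–Hilado inequality with NO further hypothesis
  -- (abc-iut-w5-d244 p442412); then abc-iut-S2's degree-one display ([IUTchIV] Cor 2.2 (ii) / 2.3 at d = 1; the volume side is a theorem at d_mod = 1)
  refine ThetaPartIIDisplay.vojtaIneq_two_degOne_of_cor312 (fun P hP hdeg l hl h5 hc h2 h5' h6 T => ?_) hε D hD
  letI := T.instFieldF; letI := T.instNumberFieldF; letI := T.instAlgebraF; letI := T.instFieldK
  letI := T.instNumberFieldK; letI := T.instAlgebraK; letI := T.instFieldFbar; letI := T.instAlgebraFbar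
  letI := T.instAlgebraKFbar; letI := T.instIsElliptic
  exact cor312Of_of_statement_settingPrVolSharpM T.D (logvAnalyticVal_analyticLogvVal (K := T.K)) T.isVolumeInputOf (M P l T)
    (archPk P l T) (archSub P l T) (Ψ P l T) (act P l T) (Mmod P l T) (region P l T) (n P l T) (lat P l T) (sig P l T) (split P l T)
    (qData P l T) (GenuineM.finite_ratPlaces_under_S T.D).toFinset
    (fun u x hu => norm_tqM_eq_one_of_not_mem T.D (ratChar u) u (natCast_ratChar_mem u) (ideleDataOf T.D T.isVolumeInputOf) x
      fun hx => hu ((Set.Finite.mem_toFinset _).mpr ⟨x, hx⟩))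
    (hst P hP hdeg l hl h5 hc h2 h5' h6 T)

/-! ## §3. The cone currencies: `ABC` from [C312] per datum and ONE landed (P,l)-level cone input — 2 explicit hypotheses each -/

/-- **`abc_of_cor312Statement_genuineM_szpiroSlack`** — p443000 with the CONE binder CUT from `hreg` to `hresSz` of
`Conditional/AbcOfSlackRegimeSzpiro.lean` (abc-iut-s2-p10 p436259): the hull estimate with `B_III(P,l)` ONLY at non-slot-constant data of points
with `2 ≤ d_mod` above abc-iut-c312-d1's explicit height threshold whose (Ind1) slot residue EXCEEDS abc-iut-s2-p1's Szpiro slack — the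
strongest landed cut (`hreg ⟹ habove ⟹ hresSz` as hypotheses: `slackRegime_of_hullRegime`, `szpiroSlackRegime_of_slackRegime`); the
downstream-certificate twin of `abc_of_SH_v10M_szpiroSlack` (p442811) and of abc-iut-C-cert-2's `abc_of_SH_v7K_szpiroSlack` (p440821).
Explicit 2 = C312 1 + CONE 1. Proof: `Conditional.ABC_of_cor312_of_szpiroSlackRegime` over §1. «`ABC` follows from the typed Cor. 3.12 at these
settings + hresSz, AS TYPED» — nothing asserted about either hypothesis; no side taken on [IUTchIII] Cor. 3.12; typed ≠ proved;
instantiated ≠ endorsed. [claim: Mochizuki2012, status: disputed] -/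
theorem abc_of_cor312Statement_genuineM_szpiroSlack
    -- [C312] p443000's binder verbatim (admissible (P,l) only)
    (hst : ∀ (P : NFPoint), P ∈ UP → ∀ (l : ℕ), l.Prime → 5 ≤ l →
      Cor22.AdmitsCore P → Cor22.CondP2 P l → Cor22.CondP5 P l → Cor22.CondP6 P l →
      ∀ (T : Cor22.ThetaVolumeDatumAt P l), letI := T.instFieldF; letI := T.instNumberFieldF; letI := T.instAlgebraF; letI := T.instFieldK;
        letI := T.instNumberFieldK; letI := T.instAlgebraK; letI := T.instFieldFbar; letI := T.instAlgebraFbar;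
        letI := T.instAlgebraKFbar; letI := T.instIsElliptic;
      (settingPrVolSharpM T.D (logvAnalyticVal_analyticLogvVal (K := T.K)) (tOfIdeleData T.D (ideleDataOf T.D T.isVolumeInputOf))
          (fun u x => tqM T.D (ratChar u) u (natCast_ratChar_mem u) (ideleDataOf T.D T.isVolumeInputOf) x)
          (M P l T) (archPk P l T) (archSub P l T) (Ψ P l T) (act P l T)
          (Mmod P l T) (region P l T) (n P l T) (lat P l T) (sig P l T) (split P l T) (qData P l T)
          (fun u x => tqM_ne_zero T.D (ratChar u) u (natCast_ratChar_mem u) (ideleDataOf T.D T.isVolumeInputOf) x)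
          (GenuineM.finite_ratPlaces_under_S T.D).toFinset
          (fun u x hu => norm_tqM_eq_one_of_not_mem T.D (ratChar u) u (natCast_ratChar_mem u) (ideleDataOf T.D T.isVolumeInputOf) x
            fun hx => hu ((Set.Finite.mem_toFinset _).mpr ⟨x, hx⟩))).Statement)
    -- [CONE] `hresSz` = `Conditional/AbcOfSlackRegimeSzpiro.lean`'s Szpiro-slack residue cut, verbatim
    (hresSz : ∀ P : NFPoint, P ∈ UP → ∀ l : ℕ, l.Prime → 5 ≤ l →
      Cor22.AdmitsCore P → Cor22.CondP2 P l → Cor22.CondP5 P l → Cor22.CondP6 P l →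
      2 ≤ Cor22.dmod P →
      40 * Real.log (((2 ^ 12 * 3 ^ 3 * 5 * Cor22.dmod P : ℕ) : ℝ) * l)
        * ((Nat.primeCounting (2 ^ 12 * 3 ^ 3 * 5 * Cor22.dmod P * l) : ℝ)
          - (2 * (Cor22.dmod P : ℝ) * (P.logDiff + Cor22.logCondAvoid P {2, l}) + Real.log (2 * 3 * 5 * (l : ℝ)))
            / Real.log 2) < Cor22.logQAvoid P {2, l} →
      ∀ T : Cor22.ThetaVolumeDatumAt P l,
        (letI := T.instFieldF; letI := T.instNumberFieldF; letI := T.instAlgebraF; letI := T.instFieldK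
         letI := T.instNumberFieldK; letI := T.instAlgebraK; letI := T.instFieldFbar; letI := T.instAlgebraFbar
         letI := T.instAlgebraKFbar; letI := T.instIsElliptic
         ¬ (∀ p ∈ T.I.supportPrimes, ∀ v w : placesOver (fieldOfModuli T.E) p,
            (Summit.ABC.IUTFork.DHData.ofInput T.I).logQloc p v = (Summit.ABC.IUTFork.DHData.ofInput T.I).logQloc p w)) →
        (letI := T.instFieldF; letI := T.instNumberFieldF; letI := T.instFieldK; letI := T.instNumberFieldK
         letI := T.instAlgebraK
         ((l : ℝ) + 1) / 4 * (4 * ((Cor22.dmod P : ℝ) - 1) / l * (P.logDiff + Cor22.logCondAvoid P {2, l})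
            + 20 / 3 * Real.log (((2 ^ 12 * 3 ^ 3 * 5 * Cor22.dmod P : ℕ) : ℝ) * l)
              * ((Nat.primeCounting (2 ^ 12 * 3 ^ 3 * 5 * Cor22.dmod P * l) : ℝ)
                - ((T.I.supportPrimes.filter (· ≤ 2 ^ 12 * 3 ^ 3 * 5 * Cor22.dmod P * l)).card : ℝ))) <
           T.I.X.slotResidue T.I.supportPrimes) →
        T.HullEstimateOf
          (((l : ℝ) + 1) / 4 *
            ((1 + 12 * (Cor22.dmod P : ℝ) / l) * (P.logDiff + Cor22.logCondAvoid P {2, l})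
              + 2 * Real.log l + 52
              + 20 / 3 * Real.log (((2 ^ 12 * 3 ^ 3 * 5 * Cor22.dmod P : ℕ) : ℝ) * (l : ℝ))
                * (Nat.primeCounting (2 ^ 12 * 3 ^ 3 * 5 * Cor22.dmod P * l) : ℝ)))) :
    _root_.ABC :=
  ABC_of_cor312_of_szpiroSlackRegime (GenuineMStatement.cor312AtDatum_of_statement (hst := hst)) hresSz

/-- **`abc_of_cor312Statement_genuineM_szpiroSuff`** — p443000 with the CONE binder replaced by abc-iut-s2-p1's DATUM-FREE Szpiro-type
inequality WITH π-SLACK at `d_mod ≥ 2` (`Conditional/AbcOfSHvolSzpiroSuff.lean` p435048, `hSz` verbatim: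
`log(q^{∤{2,l}}(λ)) ≤ (24(d_mod−1)/l)·(log-diff + log-cond) + 40·log(d*·l)·max(0, π(d*·l) − …)`; `d_mod = 1` is abc-iut-S3's pinned theorem,
inside) — the ONLY admissible form of the Szpiro trade: the slack-free form is refuted as a ∀-binder over admissible data (abc-iut-s2-p5
`QuadWitness.not_szpiroPure`, p442698). Explicit 2 = C312 1 + CONE 1, the cone input a statement about `λ` and `l` only — of the same TYPE
as `ABC`. Proof: `Conditional.ABC_of_cor312_of_szpiroSuff` over §1. «`ABC` follows from the typed Cor. 3.12 at these settings + hSz, AS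
TYPED» — nothing asserted about either hypothesis; no side taken on [IUTchIII] Cor. 3.12; typed ≠ proved. [claim: Mochizuki2012, status: disputed] -/
theorem abc_of_cor312Statement_genuineM_szpiroSuff
    -- [C312] p443000's binder verbatim (admissible (P,l) only)
    (hst : ∀ (P : NFPoint), P ∈ UP → ∀ (l : ℕ), l.Prime → 5 ≤ l →
      Cor22.AdmitsCore P → Cor22.CondP2 P l → Cor22.CondP5 P l → Cor22.CondP6 P l →
      ∀ (T : Cor22.ThetaVolumeDatumAt P l), letI := T.instFieldF; letI := T.instNumberFieldF; letI := T.instAlgebraF; letI := T.instFieldK;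
        letI := T.instNumberFieldK; letI := T.instAlgebraK; letI := T.instFieldFbar; letI := T.instAlgebraFbar;
        letI := T.instAlgebraKFbar; letI := T.instIsElliptic;
      (settingPrVolSharpM T.D (logvAnalyticVal_analyticLogvVal (K := T.K)) (tOfIdeleData T.D (ideleDataOf T.D T.isVolumeInputOf))
          (fun u x => tqM T.D (ratChar u) u (natCast_ratChar_mem u) (ideleDataOf T.D T.isVolumeInputOf) x)
          (M P l T) (archPk P l T) (archSub P l T) (Ψ P l T) (act P l T)
          (Mmod P l T) (region P l T) (n P l T) (lat P l T) (sig P l T) (split P l T) (qData P l T)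
          (fun u x => tqM_ne_zero T.D (ratChar u) u (natCast_ratChar_mem u) (ideleDataOf T.D T.isVolumeInputOf) x)
          (GenuineM.finite_ratPlaces_under_S T.D).toFinset
          (fun u x hu => norm_tqM_eq_one_of_not_mem T.D (ratChar u) u (natCast_ratChar_mem u) (ideleDataOf T.D T.isVolumeInputOf) x
            fun hx => hu ((Set.Finite.mem_toFinset _).mpr ⟨x, hx⟩))).Statement)
    -- [CONE] abc-iut-s2-p1's datum-free Szpiro-type sufficient condition (π-slack form) at `d_mod ≥ 2`, verbatim
    (hSz : ∀ P : NFPoint, P ∈ UP → ∀ l : ℕ, l.Prime → 5 ≤ l →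
      Cor22.AdmitsCore P → Cor22.CondP2 P l → Cor22.CondP5 P l → Cor22.CondP6 P l → 2 ≤ Cor22.dmod P →
      Cor22.logQAvoid P {2, l} ≤
        24 * ((Cor22.dmod P : ℝ) - 1) / l * (P.logDiff + Cor22.logCondAvoid P {2, l})
        + 40 * Real.log (((2 ^ 12 * 3 ^ 3 * 5 * Cor22.dmod P : ℕ) : ℝ) * l)
          * max 0 (((Nat.primeCounting (2 ^ 12 * 3 ^ 3 * 5 * Cor22.dmod P * l) : ℝ)
            - (2 * (Cor22.dmod P : ℝ) * (P.logDiff + Cor22.logCondAvoid P {2, l}) + Real.log (2 * 3 * 5 * (l : ℝ)))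
              / Real.log 2))) :
    _root_.ABC :=
  ABC_of_cor312_of_szpiroSuff (GenuineMStatement.cor312AtDatum_of_statement (hst := hst)) hSz

open scoped Classical in
/-- **`abc_of_cor312Statement_genuineM_pointMixedSzpiro`** — p443000 with the CONE binder replaced by abc-iut-s2-p1's DATUM-FREE mixed-height
Szpiro-type bound `hMix` (`LDHGenuineHullRegimeMixedPoint.lean` p438083, TRADE 6 of the s2 SCOREBOARD; verbatim, same `Classical` decidability
context): at every admissible `(λ, l)` a finite set of primes containing the unequal-local-heights primes of `j(λ)` over `ℚ(j(λ))`, whose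
weighted `{2,l}`-avoiding local heights are bounded by the Szpiro-max slack — the currency in which abc-iut-s2-p1's sufficiency / necessity
sandwich of the cone residue is stated (p438083 / p438393). Explicit 2 = C312 1 + CONE 1. Proof: `ABC_of_cor312_of_pointMixedSzpiro` over §1.
«`ABC` follows from the typed Cor. 3.12 at these settings + hMix, AS TYPED» — nothing asserted about either hypothesis; no side taken on
[IUTchIII] Cor. 3.12; typed ≠ proved; instantiated ≠ endorsed. [claim: Mochizuki2012, status: disputed] -/
theorem abc_of_cor312Statement_genuineM_pointMixedSzpiro
    -- [C312] p443000's binder verbatim (admissible (P,l) only)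
    (hst : ∀ (P : NFPoint), P ∈ UP → ∀ (l : ℕ), l.Prime → 5 ≤ l →
      Cor22.AdmitsCore P → Cor22.CondP2 P l → Cor22.CondP5 P l → Cor22.CondP6 P l →
      ∀ (T : Cor22.ThetaVolumeDatumAt P l), letI := T.instFieldF; letI := T.instNumberFieldF; letI := T.instAlgebraF; letI := T.instFieldK;
        letI := T.instNumberFieldK; letI := T.instAlgebraK; letI := T.instFieldFbar; letI := T.instAlgebraFbar;
        letI := T.instAlgebraKFbar; letI := T.instIsElliptic;
      (settingPrVolSharpM T.D (logvAnalyticVal_analyticLogvVal (K := T.K)) (tOfIdeleData T.D (ideleDataOf T.D T.isVolumeInputOf))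
          (fun u x => tqM T.D (ratChar u) u (natCast_ratChar_mem u) (ideleDataOf T.D T.isVolumeInputOf) x)
          (M P l T) (archPk P l T) (archSub P l T) (Ψ P l T) (act P l T)
          (Mmod P l T) (region P l T) (n P l T) (lat P l T) (sig P l T) (split P l T) (qData P l T)
          (fun u x => tqM_ne_zero T.D (ratChar u) u (natCast_ratChar_mem u) (ideleDataOf T.D T.isVolumeInputOf) x)
          (GenuineM.finite_ratPlaces_under_S T.D).toFinset
          (fun u x hu => norm_tqM_eq_one_of_not_mem T.D (ratChar u) u (natCast_ratChar_mem u) (ideleDataOf T.D T.isVolumeInputOf) x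
            fun hx => hu ((Set.Finite.mem_toFinset _).mpr ⟨x, hx⟩))).Statement)
    -- [CONE] abc-iut-s2-p1's datum-free mixed-height Szpiro-type bound, verbatim
    (hMix : ∀ P : NFPoint, P ∈ UP → ∀ l : ℕ, l.Prime → 5 ≤ l →
      Cor22.AdmitsCore P → Cor22.CondP2 P l → Cor22.CondP5 P l → Cor22.CondP6 P l →
      ∃ M : Finset ℕ,
        (∀ p : ℕ, p.Prime →
          (¬ ∀ V W : HeightOneSpectrum (𝓞 ↥(IntermediateField.adjoin ℚ ({Cor22.jInv P.x} : Set P.F))),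
            V ∈ placesOver _ p → W ∈ placesOver _ p →
            (if ord _ V (Cor22.jMod P) < 0 ∧ ((2 : ℕ) : 𝓞 _) ∉ V.asIdeal ∧ ((l : ℕ) : 𝓞 _) ∉ V.asIdeal
              then ((-ord _ V (Cor22.jMod P) : ℤ) : ℝ) * logNorm _ V / (localDegree _ V : ℝ) else 0) =
            (if ord _ W (Cor22.jMod P) < 0 ∧ ((2 : ℕ) : 𝓞 _) ∉ W.asIdeal ∧ ((l : ℕ) : 𝓞 _) ∉ W.asIdeal
              then ((-ord _ W (Cor22.jMod P) : ℤ) : ℝ) * logNorm _ W / (localDegree _ W : ℝ) else 0)) → p ∈ M) ∧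
        ((l : ℝ) + 1) / 24 *
            ∑ p ∈ M, ∑ V : placesOver ↥(IntermediateField.adjoin ℚ ({Cor22.jInv P.x} : Set P.F)) p,
              (if ord _ V.1 (Cor22.jMod P) < 0 ∧ ((2 : ℕ) : 𝓞 _) ∉ V.1.asIdeal ∧ ((l : ℕ) : 𝓞 _) ∉ V.1.asIdeal then
                weight _ V.1 * (((-ord _ V.1 (Cor22.jMod P) : ℤ) : ℝ) * logNorm _ V.1 / (localDegree _ V.1 : ℝ))
               else 0) ≤
          ((l : ℝ) + 1) / 4 * (4 * ((Cor22.dmod P : ℝ) - 1) / l * (P.logDiff + Cor22.logCondAvoid P {2, l})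
            + 20 / 3 * Real.log (((2 ^ 12 * 3 ^ 3 * 5 * Cor22.dmod P : ℕ) : ℝ) * l)
              * max 0 (((Nat.primeCounting (2 ^ 12 * 3 ^ 3 * 5 * Cor22.dmod P * l) : ℝ)
                - (2 * (Cor22.dmod P : ℝ) * (P.logDiff + Cor22.logCondAvoid P {2, l}) + Real.log (2 * 3 * 5 * (l : ℝ)))
                  / Real.log 2)))) :
    _root_.ABC :=
  ABC_of_cor312_of_pointMixedSzpiro (GenuineMStatement.cor312AtDatum_of_statement (hst := hst)) hMix

end Family

end Summit.ABC.IUTFork.Conditional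

end
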